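import Literature.NumberTheory.PAdicHodge.AinfWeierstrassTateModuleGeom
import Mathlib.Analysis.Normed.Ring.Ultra
import HarnessLib

/-!
# The matching `T_p E(F̄) ≅ T_pŴ(𝒪_{ℂ_F})` is UNCONDITIONAL at a prime of good supersingular reduction of `W/ℤ`

Topic `Literature/NumberTheory/PAdicHodge`; discharges the hypothesis `hss : E[p^∞](ℂ_F) ⊂ E₁(ℂ_F)` of
`AinfWeierstrassTateModuleGeom.tateGeomEquivTatePt` for an integral Weierstrass equation `W/ℤ` and an odd prime `p` with
`p ∤ Δ_W` and vanishing Hasse invariant of `W mod p` (good SUPERSINGULAR reduction), over any `p`-adic field `F`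
(`‖p‖_{ℂ_F} < 1`):

* `eq_zero_of_prime_zsmul_eq_zero_map_of_hasseCoeff_eq_zero` — a supersingular elliptic curve over a finite field has no point of
  order `p` over ANY field extension (its `p`-division polynomial is a non-zero constant, tree `exists_ΨSq_prime_eq_C_of_hasseCoeff_eq_zero`);
* `norm_intCast_eq_one_of_not_dvd` (`‖n‖_{ℂ_F} = 1` for `p ∤ n`), `isUnit_Δ_ballIntModel` (`W ⊗ 𝒪_{ℂ_F}` has unit discriminant when
  `p ∤ Δ`), `charP_residueField_unitBall`, the identification of the reduction of `W ⊗ 𝒪_{ℂ_F}` with a base change of `W mod p`;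
* **`mem_kernel_of_pow_prime_smul_eq_zero_C`**: `E[pⁿ](ℂ_F) ⊂ E₁(ℂ_F)`;
* **`tateGeomEquivTatePtSS : (curveF W).tateModule p ≃ₗ[ℤ_p] TatePt F p W`** and **`tateGeomEquivTatePtSS_galois`** (`galoisRepTate ↔ tatePtRep`)
  — with no hypothesis left besides `p` odd, `p ∤ Δ_W`, `A_p(W mod p) = 0`, `‖p‖_{ℂ_F} < 1`.

BSD / K★: this is the unramified good-supersingular case (the LT road of `kato-lever-hDR-programme.md` §(f′)); K★'s additive cells
need the 𝒪_{F'}-model (R1). Nothing about elliptic curves over number fields is proved here.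

## References
* J. H. Silverman, *The Arithmetic of Elliptic Curves* (2009), III.§7, V.3.1, VII.2.1–2.2. [SilvermanAEC2009]
* J.-P. Serre, *Propriétés galoisiennes…*, Invent. Math. 15 (1972), §1.11. [Serre1972]
-/

noncomputable section

open scoped Classical NNReal
open Field Polynomial

namespace Literature.NumberTheory.EllipticCurves

/-- **A supersingular elliptic curve over a finite field of odd characteristic `p` has no point of order `p` over ANY field
extension**: `ΨSq_p = c ≠ 0` is constant (tree `exists_ΨSq_prime_eq_C_of_hasseCoeff_eq_zero`), and the abscissa of a point of order `p`
would be a root of it. [cite: SilvermanAEC2009, Thm. V.3.1(a)] -/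
theorem eq_zero_of_prime_zsmul_eq_zero_map_of_hasseCoeff_eq_zero {K : Type*} [Field K] [Fintype K] {p : ℕ} [Fact p.Prime]
    [CharP K p] (W₀ : WeierstrassCurve K) [W₀.IsElliptic] (hp2 : p ≠ 2) (hA : W₀.hasseCoeff p = 0)
    {k' : Type*} [Field k'] (f : K →+* k') (Q : (W₀.map f).toAffine.Point) (hQ : (p : ℤ) • Q = 0) : Q = 0 := by
  rcases Q with _ | ⟨x, y, h⟩
  · rfl
  · exfalso
    obtain ⟨c, hc, hΨ⟩ := W₀.exists_ΨSq_prime_eq_C_of_hasseCoeff_eq_zero p hp2 hA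
    have h0 := ((W₀.map f).zsmul_some_eq_zero_iff_eval_ΨSq h p).mp hQ
    rw [WeierstrassCurve.map_ΨSq, hΨ, Polynomial.map_C, eval_C, map_eq_zero_iff f f.injective] at h0
    exact hc h0

end Literature.NumberTheory.EllipticCurves

namespace Literature.NumberTheory.PAdicHodge

open Literature.NumberTheory.GaloisRepresentations
open Literature.NumberTheory.GaloisRepresentations.IsNonarchimedeanLocalField
open Literature.NumberTheory.GaloisRepresentations.LubinTate
open Literature.NumberTheory.EllipticCurves Literature.NumberTheory.EllipticCurves.FormalGroupChart

namespace AinfTop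

section Units

variable {K : Type*} [NontriviallyNormedField K] [IsUltrametricDist K] {p : ℕ} [Fact p.Prime]

/-- **`‖n‖ = 1` for an integer `n` prime to `p`** in an ultrametric field with `‖p‖ < 1` (Bézout: `a p + b n = 1`).
[cite: SilvermanAEC2009, VII.§1] -/
theorem norm_intCast_eq_one_of_not_dvd (hp : ‖(p : K)‖ < 1) {n : ℤ} (hn : ¬ (p : ℤ) ∣ n) : ‖(n : K)‖ = 1 := by
  refine le_antisymm (IsUltrametricDist.norm_intCast_le_one K n) (not_lt.mp fun hlt => ?_)
  have hcop : IsCoprime (p : ℤ) n :=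
    (Nat.prime_iff_prime_int.mp (Fact.out : p.Prime)).irreducible.coprime_iff_not_dvd.mpr hn
  obtain ⟨a, b, hab⟩ := hcop
  have h1 : ‖((a * p + b * n : ℤ) : K)‖ = 1 := by rw [hab, Int.cast_one, norm_one]
  have h2 : ‖((a * p + b * n : ℤ) : K)‖ < 1 := by
    push_cast
    refine (IsUltrametricDist.norm_add_le_max _ _).trans_lt (max_lt ?_ ?_)
    · rw [norm_mul]
      exact (mul_le_of_le_one_left (norm_nonneg _) (IsUltrametricDist.norm_intCast_le_one K a)).trans_lt hp
    · rw [norm_mul]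
      exact (mul_le_of_le_one_left (norm_nonneg _) (IsUltrametricDist.norm_intCast_le_one K b)).trans_lt hlt
  exact absurd h1 (ne_of_lt h2)

/-- An element of `𝒪_K` is a unit iff it has norm `1`. [cite: CasselsFrohlichANT1967, Ch. VI §3.2] -/
theorem isUnit_unitBall_iff {x : unitBall K} : IsUnit x ↔ ‖(x : K)‖ = 1 := by
  rw [(Valuation.integer.integers (NormedField.valuation (K := K))).isUnit_iff_valuation_eq_one,
    ← NNReal.coe_inj, NormedField.valuation_apply, coe_nnnorm, NNReal.coe_one]
  rfl

variable (W : WeierstrassCurve ℤ)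

/-- **`W ⊗ 𝒪_K` has unit discriminant when `p ∤ Δ_W`** (and `‖p‖_K < 1`). [cite: SilvermanAEC2009, VII.§1] -/
theorem isUnit_Δ_ballIntModel (hp : ‖(p : K)‖ < 1) (hΔ : ¬ (p : ℤ) ∣ W.Δ) : IsUnit (ballIntModel K W).Δ := by
  rw [ballIntModel, WeierstrassCurve.map_Δ, isUnit_unitBall_iff]
  have h : ((algebraMap ℤ (unitBall K) W.Δ : unitBall K) : K) = (W.Δ : K) := by
    rw [algebraMap_int_eq, eq_intCast]; rfl
  rw [h]
  exact norm_intCast_eq_one_of_not_dvd hp hΔ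

/-- `p` lies in the maximal ideal of `𝒪_K`, so the residue field of `𝒪_K` has characteristic `p`. [cite: SilvermanAEC2009, VII.§1] -/
theorem charP_residueField_unitBall (hp : ‖(p : K)‖ < 1) : CharP (IsLocalRing.ResidueField (unitBall K)) p := by
  refine (CharP.charP_iff_prime_eq_zero (Fact.out : p.Prime)).mpr ?_
  have hmem : ((p : ℤ) : unitBall K) ∈ IsLocalRing.maximalIdeal (unitBall K) := by
    rw [IsLocalRing.mem_maximalIdeal, mem_nonunits_iff, isUnit_unitBall_iff]
    have h : ((((p : ℤ) : unitBall K) : unitBall K) : K) = (p : K) := by push_cast; rfl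
    rw [h]; exact ne_of_lt hp
  have h := (IsLocalRing.residue_eq_zero_iff _).mpr hmem
  rwa [map_intCast, Int.cast_natCast] at h

/-- The residue map `𝔽_p → 𝒪_K/𝔪` (for `‖p‖_K < 1`). [cite: SilvermanAEC2009, VII.§1] -/
def zmodToResidueField (hp : ‖(p : K)‖ < 1) : ZMod p →+* IsLocalRing.ResidueField (unitBall K) :=
  haveI := charP_residueField_unitBall (K := K) hp
  ZMod.castHom (dvd_refl p) _

/-- **The reduction of `W ⊗ 𝒪_K` is a base change of `W mod p`.** [cite: SilvermanAEC2009, VII.§1] -/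
theorem ballIntModel_map_residue (hp : ‖(p : K)‖ < 1) :
    (ballIntModel K W).map (IsLocalRing.residue (unitBall K)) =
      (W.map (Int.castRingHom (ZMod p))).map (zmodToResidueField (K := K) hp) := by
  rw [ballIntModel, WeierstrassCurve.map_map, WeierstrassCurve.map_map]
  exact congrArg W.map (RingHom.ext_int _ _)

/-- **No `p`-torsion in the reduction of `W ⊗ 𝒪_K`** when `W mod p` is supersingular (`p` odd, `p ∤ Δ`, `A_p = 0`): over the (possibly
infinite) residue field of `𝒪_K`. [cite: SilvermanAEC2009, Thm. V.3.1(a)] -/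
theorem reduction_no_pTorsion (hp : ‖(p : K)‖ < 1) (hp2 : p ≠ 2) (hΔ : ¬ (p : ℤ) ∣ W.Δ)
    (hA : (W.map (Int.castRingHom (ZMod p))).hasseCoeff p = 0)
    (Q : ((ballIntModel K W).map (IsLocalRing.residue (unitBall K))).toAffine.Point) (hQ : (p : ℤ) • Q = 0) : Q = 0 := by
  haveI : (W.map (Int.castRingHom (ZMod p))).IsElliptic := ⟨by
    rw [WeierstrassCurve.map_Δ, isUnit_iff_ne_zero, eq_intCast, ne_eq, (ZMod.intCast_zmod_eq_zero_iff_dvd _ _)]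
    exact hΔ⟩
  set e := WeierstrassCurve.Affine.Point.congrEquiv (ballIntModel_map_residue (K := K) W hp)
  have h1 : (p : ℤ) • e Q = 0 := by rw [← map_zsmul, hQ, map_zero]
  have h2 := eq_zero_of_prime_zsmul_eq_zero_map_of_hasseCoeff_eq_zero (W.map (Int.castRingHom (ZMod p))) hp2 hA
    (zmodToResidueField (K := K) hp) (e Q) h1
  exact e.injective (h2.trans (map_zero e).symm)

variable {W}

/-- **`E[pⁿ](K) ⊂ E₁(K)`** for `W/ℤ` with good supersingular reduction at the odd prime `p` (`p ∤ Δ`, `A_p(W mod p) = 0`), over any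
complete ultrametric field `K` with `‖p‖ < 1` (e.g. `ℂ_F`). [cite: SilvermanAEC2009, Prop. VII.2.1] [cite: Serre1972, §1.11] -/
theorem mem_kernel_of_pow_prime_smul_eq_zero_ss (hp : ‖(p : K)‖ < 1) (hp2 : p ≠ 2) (hΔ : ¬ (p : ℤ) ∣ W.Δ)
    (hA : (W.map (Int.castRingHom (ZMod p))).hasseCoeff p = 0) (n : ℕ) (P : (curveOver K W).toAffine.Point)
    (hP : p ^ n • P = 0) : P ∈ kernel (NormedField.valuation (K := K)) (curveOver K W) :=
  mem_kernel_of_pow_prime_smul_eq_zero (isUnit_Δ_ballIntModel W hp hΔ) (reduction_no_pTorsion W hp hp2 hΔ hA) n P hP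

end Units

/-! ## The unconditional matching at a good supersingular prime -/

section Supersingular

variable {F : Type} [Field F] [ValuativeRel F] [TopologicalSpace F] [IsNonarchimedeanLocalField F] [CharZero F]
  (W : WeierstrassCurve ℤ) (p : ℕ) [Fact p.Prime]

variable (F) in
/-- **`T_p E(F̄) ≃ₗ[ℤ_p] T_pŴ(𝒪_{ℂ_F})`, unconditionally, at an odd prime `p` of good SUPERSINGULAR reduction of `W/ℤ`** (`p ∤ Δ_W`,
`A_p(W mod p) = 0`), for any `p`-adic field `F` (`‖p‖_{ℂ_F} < 1`). [cite: SilvermanAEC2009, Prop. VII.2.2] [cite: Tate1967, §4] -/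
def tateGeomEquivTatePtSS (hp : ‖(p : CompletedAlgClosure F)‖ < 1) (hp2 : p ≠ 2) (hΔ : ¬ (p : ℤ) ∣ W.Δ)
    (hA : (W.map (Int.castRingHom (ZMod p))).hasseCoeff p = 0) :
    (curveF F W).tateModule p ≃ₗ[ℤ_[p]] TatePt F p W :=
  tateGeomEquivTatePt F W p (fun h => hΔ (h ▸ dvd_zero _)) (mem_kernel_of_pow_prime_smul_eq_zero_ss hp hp2 hΔ hA)

/-- **Γ_F-equivariance**: `tateGeomEquivTatePtSS` intertwines `galoisRepTate` (on the geometric Tate module) with `tatePtRep` (on the Tate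
module of the formal group, where `∫ω` and `HT` live). [cite: SilvermanAEC2009, III.§7] [cite: Tate1967, §4] -/
theorem tateGeomEquivTatePtSS_galois (hp : ‖(p : CompletedAlgClosure F)‖ < 1) (hp2 : p ≠ 2) (hΔ : ¬ (p : ℤ) ∣ W.Δ)
    (hA : (W.map (Int.castRingHom (ZMod p))).hasseCoeff p = 0) (σ : absoluteGaloisGroup F) (τ : (curveF F W).tateModule p) :
    tateGeomEquivTatePtSS F W p hp hp2 hΔ hA ((curveF F W).galoisRepTate p σ τ) =
      tatePtRep F p W σ (tateGeomEquivTatePtSS F W p hp hp2 hΔ hA τ) :=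
  tateGeomEquivTatePt_galois W _ _ σ τ

end Supersingular

end AinfTop

end Literature.NumberTheory.PAdicHodge

end
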